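import Summits.HodgeConjecture.Ring2.NonSimpleFivefoldsHodge
import Summits.HodgeConjecture.Ring2.NonSimpleFourfoldsCaseA
import HarnessLib

/-!
# Non-simple complex abelian FIVEFOLDS, part 3: the EXACT residual shapes of Moonen–Zarhin 1999 Thm. 0.2 (4) in the tree

Cell `pub-hodge-ring2` (HONEST FRAMING: research route conditional on HC_CM; not a corollary; Q11.4-sentence-2 already
refuted in dim ≥ 3), Literature lane (lit seat, generation 59, programme R27, part 3; parts 1–2 =
`Ring2/NonSimpleFivefoldsRows`, `Ring2/NonSimpleFivefoldsHodge`). Theorems only (no definition, no named fact, no `sorry`);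
nothing here assumes HC_CM. NEW as stated (a census statement on tree theorems), hence under `Summits/`.

The master theorem of part 2, `isStablyNondegenerate_of_dim_eq_five_of_not_isSimple_of`, displays two rows of Moonen–Zarhin's
§5 — (5.10) «`X ∼ Y₁ × Y₂`, `Y₁` a simple abelian surface [of CM type], `Y₂` a simple abelian threefold [of Type 4] … If `Y₂`
is not of CM-type then Lemma (3.6) readily gives `Hg(X) = Hg(Y₁) × Hg(Y₂)`» and (5.11), `d_max = 3` «`Y` is isogenous to a
product of an elliptic curve `Y₁` and a simple abelian threefold `Y₂` … possibly after interchanging the roles of `E` and `Y₁`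
we find that there does not exist an embedding of `End⁰(E)` into the center of `End⁰(Y)` … Again by Proposition (3.8)»
(Math. Ann. 315 (1999), chunk p0010 L18–L64 [corpus: paper:arxiv-math_9901113]) — as hypotheses. This file turns the display
into a DICHOTOMY BY NAME: a non-simple complex abelian fivefold without simple fourfold factor outside (e)/(f) IS stably
nondegenerate, OR is isogenous to one of the two residual shapes (with all the printed side conditions, so that a census
seat can enumerate them and a future proof of Lemma (3.6) for rank-two centres discharges them by name).

* **`isStablyNondegenerate_or_exists_residual_of_dim_eq_five_of_not_isSimple`** — (D), or `X ∼ S × T` (`S` simple CM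
  surface, `T` simple threefold with a factor of Type IV and not of CM type), or `X ∼ E₁ × (E₂ × T)` (two non-isogenous CM
  elliptic curves whose fields do not embed in `End⁰(T)`, `T` as before).
* `hodgeConjectureFor_powSucc_or_exists_residual_of_dim_eq_five_of_not_isSimple` — the same with the Hodge conjecture
  for all powers in the first branch; `isStablyNondegenerate_of_dim_eq_five_of_not_isSimple_of_rows` — the master theorem
  with the two rows stated GLOBALLY (the shape a future rank-two Prop. (3.8) theorem discharges); `not_isOfCMType_of_residual`;
  `hodgeConjectureFor_of_isIsogenous_powSucc_of_dim_le_five_of_forall_factor_dim_le_two`.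
* §2 **`isStablyNondegenerate_of_dim_le_five_of`** — Moonen–Zarhin Thm. 0.1 (4) AND Thm. 0.2 (4) in ONE statement: every
  complex abelian variety of dimension `≤ 5`, not a simple fivefold, without simple fourfold isogeny factor, outside the
  printed cases (a)/(e)/(f) (ONE hypothesis: no CM elliptic curve `E` and simple threefold `T`, both isogeny factors, with
  `End⁰(E) ↪ End⁰(T)`), granted the two fivefold rows, is stably nondegenerate (dimension `≤ 3`: R20; `4`: gen 59's
  `Ring2.NonSimpleFourfolds.isStablyNondegenerate_of_dim_eq_four_of_not_isSimple_of_not_caseA`; `5`: part 2);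
  `hodgeConjectureFor_powSucc_of_dim_le_five_of`.
* §3 CLASS-TARGET DISPLAYS (`Ring2.ClassTargets.HCOnClass`, the census currency of the cell): unconditional
  `hcOnClass_avDominatedBy_powSucc_dim_le_five_factors_dim_le_two`, `hcOnClass_avDominatedBy_powSucc_curve_prod_surface_prod_surface`;
  modulo the two GLOBAL rows `hcOnClass_avDominatedBy_powSucc_dim_le_five_of_rows`.

## References
* [MoonenZarhin1999LowDim] B. Moonen, Yu. Zarhin, Math. Ann. 315 (1999) 711–733: Thm. 0.2 (4), Lemma (3.6), Prop. (3.8),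
  §5 (5.10)–(5.11) [corpus: paper:arxiv-math_9901113 chunks p0002 L1–L7, p0007 L16–L78, p0010 L18–L64].
  [cite: MoonenZarhin1999LowDim, Thm. 0.2 (4) and §5 (5.10)–(5.11)]
* [MumfordAV1970] D. Mumford, *Abelian Varieties* (1970), §19 Thm. 1 and Cor. 1–2 (pp. 173–174). [cite: MumfordAV1970, §19 Thm. 1 (pp. 173–174)]
* [Deligne2000] P. Deligne, *The Hodge conjecture* (Clay problem description, 2000/2006), §1. [cite: Deligne2000, §1]
* [RamonMari2008] J. J. Ramón Marí, Collect. Math. 59 (2008), Prop. 2.18. [cite: RamonMari2008, Prop. 2.18]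
-/

noncomputable section

open CategoryTheory CategoryTheory.Limits

namespace Summit.HodgeConjecture.Ring2.NonSimpleFivefolds

open Literature.AlgebraicGeometry.Motives (AbelianVariety)
open Literature.AlgebraicGeometry.Motives.AbelianVariety
open Literature.AlgebraicGeometry.HodgeTheory
open Literature.AlgebraicGeometry.Milne1999
open Summit.HodgeConjecture.CorCM
open Summit.HodgeConjecture.CorCM.Domination
open Summit.HodgeConjecture.HodgeConjecture.Ring2.ClassTargets (HCOnClass)

variable {X : AbelianVariety ℂ}

/-! ### §1 The residual shapes -/

/-- **The EXACT residual shapes.** A non-simple complex abelian fivefold `X` without simple isogeny factor of dimension `4`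
and outside the cases (e)/(f) is stably nondegenerate, OR isogenous to `S × T` with `S` a simple CM surface and `T` a simple
threefold with a factor of Type IV and not of CM type (Moonen–Zarhin (5.10), proved in print by Lemma (3.6)), OR isogenous
to `E₁ × (E₂ × T)` with `E₁`, `E₂` non-isogenous elliptic curves of CM type, `T` as before, and neither `End⁰(E₁)` nor
`End⁰(E₂)` embedding in `End⁰(T)` ((5.11), `d_max = 3`, proved in print by Prop. (3.8)). [cite: MoonenZarhin1999LowDim, Thm. 0.2 (4) and §5 (5.10)–(5.11)]
[cite: MumfordAV1970, §19 Thm. 1 (pp. 173–174)] -/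
theorem isStablyNondegenerate_or_exists_residual_of_dim_eq_five_of_not_isSimple (hX5 : X.dim = 5) (hX : ¬ X.IsSimple)
    (h4 : ∀ F : AbelianVariety ℂ, F.IsSimple → F.dim = 4 → ¬ AVDominatedBy F X)
    (hna : ¬ ∃ E T : AbelianVariety ℂ, E.dim = 1 ∧ IsOfCMType E ∧ T.IsSimple ∧ T.dim = 3 ∧
      AVDominatedBy E X ∧ AVDominatedBy T X ∧ Nonempty (E.endAlgebra →+* T.endAlgebra)) :
    IsStablyNondegenerate X ∨
      (∃ S T : AbelianVariety ℂ, S.dim = 2 ∧ S.IsSimple ∧ IsOfCMType S ∧ T.dim = 3 ∧ T.IsSimple ∧ ¬ IsOfCMType T ∧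
        ¬ HasNoTypeIVFactor T ∧ AbelianVariety.IsIsogenous (S.prod T) X) ∨
      (∃ E₁ E₂ T : AbelianVariety ℂ, E₁.dim = 1 ∧ E₂.dim = 1 ∧ IsOfCMType E₁ ∧ IsOfCMType E₂ ∧
        ¬ AbelianVariety.IsIsogenous E₁ E₂ ∧ T.dim = 3 ∧ T.IsSimple ∧ ¬ IsOfCMType T ∧ ¬ HasNoTypeIVFactor T ∧
        IsEmpty (E₁.endAlgebra →+* T.endAlgebra) ∧ IsEmpty (E₂.endAlgebra →+* T.endAlgebra) ∧
        AbelianVariety.IsIsogenous (E₁.prod (E₂.prod T)) X) := by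
  by_cases hS : ∃ S T : AbelianVariety ℂ, S.dim = 2 ∧ S.IsSimple ∧ IsOfCMType S ∧ T.dim = 3 ∧ T.IsSimple ∧
      ¬ IsOfCMType T ∧ ¬ HasNoTypeIVFactor T ∧ AbelianVariety.IsIsogenous (S.prod T) X
  · exact Or.inr (Or.inl hS)
  by_cases hE : ∃ E₁ E₂ T : AbelianVariety ℂ, E₁.dim = 1 ∧ E₂.dim = 1 ∧ IsOfCMType E₁ ∧ IsOfCMType E₂ ∧
      ¬ AbelianVariety.IsIsogenous E₁ E₂ ∧ T.dim = 3 ∧ T.IsSimple ∧ ¬ IsOfCMType T ∧ ¬ HasNoTypeIVFactor T ∧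
      IsEmpty (E₁.endAlgebra →+* T.endAlgebra) ∧ IsEmpty (E₂.endAlgebra →+* T.endAlgebra) ∧
      AbelianVariety.IsIsogenous (E₁.prod (E₂.prod T)) X
  · exact Or.inr (Or.inr hE)
  refine Or.inl (isStablyNondegenerate_of_dim_eq_five_of_not_isSimple_of hX5 hX h4 hna ?_ ?_)
  · intro S T hS2 hSs hSc hT3 hTs hTc hT4 hrel
    exact absurd ⟨S, T, hS2, hSs, hSc, hT3, hTs, hTc, hT4, hrel⟩ hS
  · intro E₁ E₂ T h₁ h₂ c₁ c₂ hni hT3 hTs hTc hT4 i₁ i₂ hrel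
    exact absurd ⟨E₁, E₂, T, h₁, h₂, c₁, c₂, hni, hT3, hTs, hTc, hT4, i₁, i₂, hrel⟩ hE

/-- **The Hodge conjecture for all powers, or a residual shape.** [cite: MoonenZarhin1999LowDim, Thm. 0.2 (4) and §5 (5.10)–(5.11)] -/
theorem hodgeConjectureFor_powSucc_or_exists_residual_of_dim_eq_five_of_not_isSimple (hX5 : X.dim = 5)
    (hX : ¬ X.IsSimple) (h4 : ∀ F : AbelianVariety ℂ, F.IsSimple → F.dim = 4 → ¬ AVDominatedBy F X)
    (hna : ¬ ∃ E T : AbelianVariety ℂ, E.dim = 1 ∧ IsOfCMType E ∧ T.IsSimple ∧ T.dim = 3 ∧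
      AVDominatedBy E X ∧ AVDominatedBy T X ∧ Nonempty (E.endAlgebra →+* T.endAlgebra)) :
    (∀ N : ℕ, HodgeConjectureFor (X.powSucc N).dim (X.powSucc N).X) ∨
      (∃ S T : AbelianVariety ℂ, S.dim = 2 ∧ S.IsSimple ∧ IsOfCMType S ∧ T.dim = 3 ∧ T.IsSimple ∧ ¬ IsOfCMType T ∧
        ¬ HasNoTypeIVFactor T ∧ AbelianVariety.IsIsogenous (S.prod T) X) ∨
      (∃ E₁ E₂ T : AbelianVariety ℂ, E₁.dim = 1 ∧ E₂.dim = 1 ∧ IsOfCMType E₁ ∧ IsOfCMType E₂ ∧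
        ¬ AbelianVariety.IsIsogenous E₁ E₂ ∧ T.dim = 3 ∧ T.IsSimple ∧ ¬ IsOfCMType T ∧ ¬ HasNoTypeIVFactor T ∧
        IsEmpty (E₁.endAlgebra →+* T.endAlgebra) ∧ IsEmpty (E₂.endAlgebra →+* T.endAlgebra) ∧
        AbelianVariety.IsIsogenous (E₁.prod (E₂.prod T)) X) := by
  rcases isStablyNondegenerate_or_exists_residual_of_dim_eq_five_of_not_isSimple hX5 hX h4 hna with hD | hS | hE
  · exact Or.inl fun N => hD.hodgeConjectureFor_powSucc N
  · exact Or.inr (Or.inl hS)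
  · exact Or.inr (Or.inr hE)

/-- **The master theorem with the two rows stated GLOBALLY** (the shape in which a future tree theorem «Prop. (3.8) /
Lemma (3.6) for a cofactor with rank-two centre» would discharge them): if `S × T` is stably nondegenerate for every simple
CM surface `S` and simple threefold `T` with a factor of Type IV not of CM type, and `E₁ × (E₂ × T)` for every two
non-isogenous CM elliptic curves whose fields do not embed in `End⁰(T)` and such `T`, then every non-simple complex abelian
fivefold without simple fourfold factor outside (e)/(f) is stably nondegenerate. [cite: MoonenZarhin1999LowDim, Thm. 0.2 (4) and §5 (5.10)–(5.11)] -/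
theorem isStablyNondegenerate_of_dim_eq_five_of_not_isSimple_of_rows
    (hST : ∀ S T : AbelianVariety ℂ, S.dim = 2 → S.IsSimple → IsOfCMType S → T.dim = 3 → T.IsSimple → ¬ IsOfCMType T →
      ¬ HasNoTypeIVFactor T → IsStablyNondegenerate (S.prod T))
    (hEET : ∀ E₁ E₂ T : AbelianVariety ℂ, E₁.dim = 1 → E₂.dim = 1 → IsOfCMType E₁ → IsOfCMType E₂ →
      ¬ AbelianVariety.IsIsogenous E₁ E₂ → T.dim = 3 → T.IsSimple → ¬ IsOfCMType T → ¬ HasNoTypeIVFactor T →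
      IsEmpty (E₁.endAlgebra →+* T.endAlgebra) → IsEmpty (E₂.endAlgebra →+* T.endAlgebra) →
      IsStablyNondegenerate (E₁.prod (E₂.prod T)))
    (hX5 : X.dim = 5) (hX : ¬ X.IsSimple) (h4 : ∀ F : AbelianVariety ℂ, F.IsSimple → F.dim = 4 → ¬ AVDominatedBy F X)
    (hna : ¬ ∃ E T : AbelianVariety ℂ, E.dim = 1 ∧ IsOfCMType E ∧ T.IsSimple ∧ T.dim = 3 ∧
      AVDominatedBy E X ∧ AVDominatedBy T X ∧ Nonempty (E.endAlgebra →+* T.endAlgebra)) :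
    IsStablyNondegenerate X :=
  isStablyNondegenerate_of_dim_eq_five_of_not_isSimple_of hX5 hX h4 hna
    (fun S T hS2 hSs hSc hT3 hTs hTc hT4 _ => hST S T hS2 hSs hSc hT3 hTs hTc hT4)
    (fun E₁ E₂ T h₁ h₂ c₁ c₂ hni hT3 hTs hTc hT4 i₁ i₂ _ => hEET E₁ E₂ T h₁ h₂ c₁ c₂ hni hT3 hTs hTc hT4 i₁ i₂)

/-- **The Hodge conjecture for everything isogenous to a power of a complex abelian variety of dimension `≤ 5` whose simple
isogeny factors have dimension `≤ 2`** — UNCONDITIONAL (part 2's `isStablyNondegenerate_of_dim_le_five_of_forall_factor_dim_le_two`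
along isogenies). [cite: MoonenZarhin1999LowDim, Thm. 0.2 (4)] [cite: MumfordAV1970, §19 Thm. 1 (pp. 173–174)] -/
theorem hodgeConjectureFor_of_isIsogenous_powSucc_of_dim_le_five_of_forall_factor_dim_le_two (h0 : 0 < X.dim)
    (h5 : X.dim ≤ 5) (h : ∀ F : AbelianVariety ℂ, F.IsSimple → 3 ≤ F.dim → ¬ AVDominatedBy F X) {Y : AbelianVariety ℂ}
    {N : ℕ} (hY : AbelianVariety.IsIsogenous Y (X.powSucc N)) : HodgeConjectureFor Y.dim Y.X :=
  (isStablyNondegenerate_of_dim_le_five_of_forall_factor_dim_le_two h0 h5 h).hodgeConjectureFor_of_isIsogenous_powSucc hY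

/-- **Both residual shapes are NOT of CM type** (their threefold factor is not), so that for fivefolds OF CM type no row is
displayed — the CorCM classification decides them all; and HC_CM says nothing about the residual shapes. [cite: MoonenZarhin1999LowDim, §5 (5.10)–(5.11)]
[cite: Milne1999, §2 p. 54] -/
theorem not_isOfCMType_of_residual {S T : AbelianVariety ℂ} (hTc : ¬ IsOfCMType T)
    (hrel : AbelianVariety.IsIsogenous (S.prod T) X) : ¬ IsOfCMType X := by
  obtain ⟨g, hg⟩ := hrel
  intro hX
  exact hTc (isOfCMType_of_avDominatedBy hX ((avDominatedBy_prod_right S T).trans_isIsogeny_hom hg))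

/-! ### §2 Dimension `≤ 5` in one statement -/

/-- **MOONEN–ZARHIN Thm. 0.1 (4) and Thm. 0.2 (4) TOGETHER.** Let `X` be a complex abelian variety with `0 < dim X ≤ 5`,
not a simple fivefold (Tankeev's case), with no simple isogeny factor of dimension `4` (cases (b)–(d), (g) and Thm. 0.2 (4)'s
proviso), and outside the printed cases (a)/(e)/(f): no elliptic curve `E` WITH complex multiplication and simple threefold
`T`, both isogeny factors of `X`, admit `End⁰(E) ↪ End⁰(T)`. Grant the two fivefold rows (5.10)/(5.11) relative to `X`
(vacuous unless `dim X = 5`). Then `B•(Xⁿ) = D•(Xⁿ)` for all `n`. [cite: MoonenZarhin1999LowDim, Thm. 0.1 (4) and Thm. 0.2 (4)]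
[cite: MumfordAV1970, §19 Thm. 1 (pp. 173–174)] -/
theorem isStablyNondegenerate_of_dim_le_five_of (h0 : 0 < X.dim) (h5 : X.dim ≤ 5) (hX : X.dim = 5 → ¬ X.IsSimple)
    (h4 : ∀ F : AbelianVariety ℂ, F.IsSimple → F.dim = 4 → ¬ AVDominatedBy F X)
    (hna : ¬ ∃ E T : AbelianVariety ℂ, E.dim = 1 ∧ IsOfCMType E ∧ T.IsSimple ∧ T.dim = 3 ∧
      AVDominatedBy E X ∧ AVDominatedBy T X ∧ Nonempty (E.endAlgebra →+* T.endAlgebra))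
    (hST : ∀ S T : AbelianVariety ℂ, S.dim = 2 → S.IsSimple → IsOfCMType S → T.dim = 3 → T.IsSimple →
      ¬ IsOfCMType T → ¬ HasNoTypeIVFactor T → AbelianVariety.IsIsogenous (S.prod T) X → IsStablyNondegenerate (S.prod T))
    (hEET : ∀ E₁ E₂ T : AbelianVariety ℂ, E₁.dim = 1 → E₂.dim = 1 → IsOfCMType E₁ → IsOfCMType E₂ →
      ¬ AbelianVariety.IsIsogenous E₁ E₂ → T.dim = 3 → T.IsSimple → ¬ IsOfCMType T → ¬ HasNoTypeIVFactor T →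
      IsEmpty (E₁.endAlgebra →+* T.endAlgebra) → IsEmpty (E₂.endAlgebra →+* T.endAlgebra) →
      AbelianVariety.IsIsogenous (E₁.prod (E₂.prod T)) X → IsStablyNondegenerate (E₁.prod (E₂.prod T))) :
    IsStablyNondegenerate X := by
  rcases Nat.lt_or_ge X.dim 4 with h3 | h4'
  · exact isStablyNondegenerate_of_dim_pos_of_dim_le_three h0 (by omega)
  rcases Nat.lt_or_ge X.dim 5 with h4'' | h5'
  · have hX4 : X.dim = 4 := by omega
    exact Summit.HodgeConjecture.Ring2.NonSimpleFourfolds.isStablyNondegenerate_of_dim_eq_four_of_not_isSimple_of_not_caseA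
      hX4 (fun hs => h4 X hs hX4 (AVDominatedBy.refl X)) hna
  · exact isStablyNondegenerate_of_dim_eq_five_of_not_isSimple_of (by omega) (hX (by omega)) h4 hna hST hEET

/-- **The Hodge conjecture for every power of every such `X`** — UNCONDITIONAL apart from the two displayed fivefold rows.
[cite: MoonenZarhin1999LowDim, Thm. 0.1 (4) and Thm. 0.2 (4)] -/
theorem hodgeConjectureFor_powSucc_of_dim_le_five_of (h0 : 0 < X.dim) (h5 : X.dim ≤ 5) (hX : X.dim = 5 → ¬ X.IsSimple)
    (h4 : ∀ F : AbelianVariety ℂ, F.IsSimple → F.dim = 4 → ¬ AVDominatedBy F X)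
    (hna : ¬ ∃ E T : AbelianVariety ℂ, E.dim = 1 ∧ IsOfCMType E ∧ T.IsSimple ∧ T.dim = 3 ∧
      AVDominatedBy E X ∧ AVDominatedBy T X ∧ Nonempty (E.endAlgebra →+* T.endAlgebra))
    (hST : ∀ S T : AbelianVariety ℂ, S.dim = 2 → S.IsSimple → IsOfCMType S → T.dim = 3 → T.IsSimple →
      ¬ IsOfCMType T → ¬ HasNoTypeIVFactor T → AbelianVariety.IsIsogenous (S.prod T) X → IsStablyNondegenerate (S.prod T))
    (hEET : ∀ E₁ E₂ T : AbelianVariety ℂ, E₁.dim = 1 → E₂.dim = 1 → IsOfCMType E₁ → IsOfCMType E₂ →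
      ¬ AbelianVariety.IsIsogenous E₁ E₂ → T.dim = 3 → T.IsSimple → ¬ IsOfCMType T → ¬ HasNoTypeIVFactor T →
      IsEmpty (E₁.endAlgebra →+* T.endAlgebra) → IsEmpty (E₂.endAlgebra →+* T.endAlgebra) →
      AbelianVariety.IsIsogenous (E₁.prod (E₂.prod T)) X → IsStablyNondegenerate (E₁.prod (E₂.prod T))) (N : ℕ) :
    HodgeConjectureFor (X.powSucc N).dim (X.powSucc N).X :=
  (isStablyNondegenerate_of_dim_le_five_of h0 h5 hX h4 hna hST hEET).hodgeConjectureFor_powSucc N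

/-! ### §3 Class-target displays (`Ring2.ClassTargets.HCOnClass`) — unconditional classes of the cell's census -/

/-- Everything dominated by a power of a complex abelian variety of dimension `≤ 5` whose simple isogeny factors have
dimension `≤ 2` is divisor-generated (`B• = D•`). [cite: MoonenZarhin1999LowDim, Thm. 0.2 (4)] [cite: MumfordAV1970, §19 Thm. 1 (pp. 173–174)] -/
theorem isDivisorGenerated_of_avDominatedBy_powSucc_of_dim_le_five_of_forall_factor_dim_le_two {B : AbelianVariety ℂ}
    (h0 : 0 < X.dim) (h5 : X.dim ≤ 5) (h : ∀ F : AbelianVariety ℂ, F.IsSimple → 3 ≤ F.dim → ¬ AVDominatedBy F X) {N : ℕ}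
    (hB : AVDominatedBy B (X.powSucc N)) : IsDivisorGenerated B :=
  isDivisorGenerated_of_avDominatedBy hB (isStablyNondegenerate_of_dim_le_five_of_forall_factor_dim_le_two h0 h5 h N)

/-- **Class target (unconditional): the Hodge conjecture on the class of complex abelian varieties dominated by a power of an
abelian variety of dimension `≤ 5` all of whose simple isogeny factors have dimension `≤ 2`.** [cite: MoonenZarhin1999LowDim, Thm. 0.2 (4)]
[cite: Deligne2000, §1] -/
theorem hcOnClass_avDominatedBy_powSucc_dim_le_five_factors_dim_le_two :
    HCOnClass fun B => ∃ (X : AbelianVariety ℂ) (N : ℕ), 0 < X.dim ∧ X.dim ≤ 5 ∧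
      (∀ F : AbelianVariety ℂ, F.IsSimple → 3 ≤ F.dim → ¬ AVDominatedBy F X) ∧ AVDominatedBy B (X.powSucc N) :=
  fun _ ⟨_, _, h0, h5, h, hB⟩ => hodgeConjectureFor_of_isDivisorGenerated _
    (isDivisorGenerated_of_avDominatedBy_powSucc_of_dim_le_five_of_forall_factor_dim_le_two h0 h5 h hB)

/-- **Class target (unconditional): the Hodge conjecture on everything dominated by a power of some `E × (S₁ × S₂)`**
(an elliptic curve times two abelian surfaces). [cite: MoonenZarhin1999LowDim, Thm. 0.2 (4)] [cite: RamonMari2008, Prop. 2.18] -/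
theorem hcOnClass_avDominatedBy_powSucc_curve_prod_surface_prod_surface :
    HCOnClass fun B => ∃ (E S₁ S₂ : AbelianVariety ℂ) (N : ℕ), E.dim = 1 ∧ S₁.dim = 2 ∧ S₂.dim = 2 ∧
      AVDominatedBy B ((E.prod (S₁.prod S₂)).powSucc N) :=
  fun _ ⟨_, _, _, N, hE, h₁, h₂, hB⟩ => hodgeConjectureFor_of_isDivisorGenerated _
    (isDivisorGenerated_of_avDominatedBy hB (isStablyNondegenerate_curve_prod_surface_prod_surface hE h₁ h₂ N))

/-- **Class target, modulo the two rows stated GLOBALLY: the Hodge conjecture on everything dominated by a power of a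
complex abelian variety of dimension `≤ 5`, not a simple fivefold, without simple fourfold isogeny factor, outside the
printed (a)/(e)/(f)** — Moonen–Zarhin Thms. 0.1 (4) + 0.2 (4) as a class of the census; the rows `hST`, `hEET` are the
only non-kernel inputs. [cite: MoonenZarhin1999LowDim, Thm. 0.1 (4) and Thm. 0.2 (4)] [cite: Deligne2000, §1] -/
theorem hcOnClass_avDominatedBy_powSucc_dim_le_five_of_rows
    (hST : ∀ S T : AbelianVariety ℂ, S.dim = 2 → S.IsSimple → IsOfCMType S → T.dim = 3 → T.IsSimple → ¬ IsOfCMType T →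
      ¬ HasNoTypeIVFactor T → IsStablyNondegenerate (S.prod T))
    (hEET : ∀ E₁ E₂ T : AbelianVariety ℂ, E₁.dim = 1 → E₂.dim = 1 → IsOfCMType E₁ → IsOfCMType E₂ →
      ¬ AbelianVariety.IsIsogenous E₁ E₂ → T.dim = 3 → T.IsSimple → ¬ IsOfCMType T → ¬ HasNoTypeIVFactor T →
      IsEmpty (E₁.endAlgebra →+* T.endAlgebra) → IsEmpty (E₂.endAlgebra →+* T.endAlgebra) →
      IsStablyNondegenerate (E₁.prod (E₂.prod T))) :
    HCOnClass fun B => ∃ (X : AbelianVariety ℂ) (N : ℕ), 0 < X.dim ∧ X.dim ≤ 5 ∧ (X.dim = 5 → ¬ X.IsSimple) ∧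
      (∀ F : AbelianVariety ℂ, F.IsSimple → F.dim = 4 → ¬ AVDominatedBy F X) ∧
      (¬ ∃ E T : AbelianVariety ℂ, E.dim = 1 ∧ IsOfCMType E ∧ T.IsSimple ∧ T.dim = 3 ∧
        AVDominatedBy E X ∧ AVDominatedBy T X ∧ Nonempty (E.endAlgebra →+* T.endAlgebra)) ∧
      AVDominatedBy B (X.powSucc N) :=
  fun _ ⟨_, N, h0, h5, hX, h4, hna, hB⟩ => hodgeConjectureFor_of_isDivisorGenerated _
    (isDivisorGenerated_of_avDominatedBy hB (isStablyNondegenerate_of_dim_le_five_of h0 h5 hX h4 hna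
      (fun S T hS2 hSs hSc hT3 hTs hTc hT4 _ => hST S T hS2 hSs hSc hT3 hTs hTc hT4)
      (fun E₁ E₂ T h₁ h₂ c₁ c₂ hni hT3 hTs hTc hT4 i₁ i₂ _ => hEET E₁ E₂ T h₁ h₂ c₁ c₂ hni hT3 hTs hTc hT4 i₁ i₂) N))

end Summit.HodgeConjecture.Ring2.NonSimpleFivefolds
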